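import Literature.AlgebraicGeometry.Motives.IntegralProjectiveSpace
import Literature.AlgebraicGeometry.Motives.VarietiesProjectiveSpaceProofs
import HarnessLib

/-!
# `ℙⁿ_L = ℙⁿ_k ×_{Spec k} Spec L` for an ARBITRARY algebra `k → L` of commutative rings

`Literature/AlgebraicGeometry/Motives/IntegralProjectiveSpace` proves the base change
`ProjBaseChangeRing.isPullback_projMap` under the hypothesis `Module.Flat k L` (used there to see that
the comparison `k[xᵢ]⁰_(s) ⊗ₖ L → L[xᵢ]⁰_(s)` is injective for every homogeneous `s`). The printed
statement (Liu 2002, Prop. 3.1.9 and Example 3.1.10 `(ℙⁿ_A)_C = ℙⁿ_C`; Görtz–Wedhorn I, (13.9)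
`ℙⁿ_S ×_S S' = ℙⁿ_{S'}`) has no flatness hypothesis, and neither does this file: it suffices to cover
`Proj` by the standard charts `D₊(xᵢ)` (Mathlib `Proj.affineOpenCoverOfIrrelevantLESpan`), on which
the comparison map is identified with the base change of a POLYNOMIAL algebra,
`k[y₁,…,yₙ] ⊗ₖ L ≅ L[y₁,…,yₙ]` (Mathlib `MvPolynomial.algebraTensorAlgEquiv`), through the chart
isomorphisms `(R[x₀,…,xₙ]_{xᵢ})₀ ≅ R[y₁,…,yₙ]` of
`Literature/AlgebraicGeometry/Motives/VarietiesProjectiveSpaceProofs` (`ProjectiveSpace.chartAlgEquiv`).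

* `irrelevant_le_span_X` — the variables generate the irrelevant ideal (any commutative ring);
* `tensorToAway_X_injective`, `tensorToAway_X_bijective` — the chartwise comparison is bijective;
* `tensorAwayIsoX`, `isPushout_away_X`, `isPullback_Spec_away_X` — the chart isomorphism and the affine squares;
* `isPullback_projMap'` — **`ℙⁿ_L ≅ ℙⁿ_k ×_k Spec L`** for every `k`-algebra `L`.

Everything is proved; no named facts. Mathlib searched (pin v4.32): `Proj.affineOpenCoverOfIrrelevantLESpan`,
`MvPolynomial.algebraTensorAlgEquiv`, `Scheme.isPullback_of_openCover`, `isPullback_SpecMap_of_isPushout`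
(used); Mathlib has no projective space base change.

## References

* Q. Liu, *Algebraic Geometry and Arithmetic Curves* (2002): Prop. 3.1.9, Example 3.1.10. [Liu2002]
* U. Görtz, T. Wedhorn, *Algebraic Geometry I: Schemes*, 2nd ed. (2020): (13.9), p. 395. [GortzWedhorn2020]
-/

noncomputable section

universe u

open CategoryTheory CategoryTheory.Limits AlgebraicGeometry HomogeneousLocalization MvPolynomial
open scoped TensorProduct

namespace Literature.AlgebraicGeometry.Motives

namespace ProjBaseChangeRing

attribute [local instance] MvPolynomial.gradedAlgebra MvPolynomial.algebraMvPolynomial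
  Literature.AlgebraicGeometry.Motives.ProjBaseChange.algebraBase

/-! ### The variables generate the irrelevant ideal; the chart isomorphism at `t = xᵢ` -/

section Chart

variable (R : Type u) [CommRing R] {n : ℕ} (i : Fin (n + 1))

/-- The variables `x₀, …, xₙ` generate the irrelevant ideal of `R[x₀, …, xₙ]` (any commutative ring
`R`; the field case is `ProjectiveSpace.irrelevant_le_span`). [folklore] -/
theorem irrelevant_le_span_X :
    (HomogeneousIdeal.irrelevant (homogeneousSubmodule (Fin (n + 1)) R)).toIdeal ≤
      Ideal.span (Set.range (X : Fin (n + 1) → MvPolynomial (Fin (n + 1)) R)) := by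
  rw [HomogeneousIdeal.toIdeal_irrelevant_le]
  intro d hd p (hp : p ∈ homogeneousSubmodule (Fin (n + 1)) R d)
  change p ∈ Ideal.span _
  rw [← Set.image_univ, MvPolynomial.mem_ideal_span_X_image]
  intro m hm
  have hdeg : m.degree = d := by
    rw [Finsupp.degree_eq_weight_one]
    exact hp (mem_support_iff.mp hm)
  by_contra! h
  refine hd.ne' (hdeg.symm.trans ((Finsupp.degree_eq_zero_iff m).mpr ?_))
  ext s
  simpa using h s

/-- The chart isomorphism `(R[x]_{t})₀ ≅ R[y₁,…,yₙ]` for an element `t` propositionally equal to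
`xᵢ` (transport of `ProjectiveSpace.chartAlgEquiv`; used with `t = φ(xᵢ)` for the base-change map
`φ`, which equals `xᵢ` but not definitionally). [folklore] -/
def chartAlgEquivOfEq (t : MvPolynomial (Fin (n + 1)) R) (ht : t = X i) :
    Away (homogeneousSubmodule (Fin (n + 1)) R) t ≃ₐ[R] MvPolynomial (Fin n) R := by
  subst ht
  exact ProjectiveSpace.chartAlgEquiv R i

/-- `chartAlgEquivOfEq` sends `yⱼ` back to `x_{i.succAbove j}/t`. [folklore] -/
theorem val_chartAlgEquivOfEq_symm_X (t : MvPolynomial (Fin (n + 1)) R) (ht : t = X i) (j : Fin n) :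
    ((chartAlgEquivOfEq R i t ht).symm (X j)).val =
      Localization.mk (X (i.succAbove j)) (⟨t ^ 1, 1, rfl⟩ : Submonoid.powers t) := by
  subst ht
  exact (congrArg HomogeneousLocalization.val (ProjectiveSpace.chartAlgEquiv_symm_X R i j)).trans
    (ProjectiveSpace.val_chartGen R i j)

end Chart

/-! ### The chartwise comparison map is bijective without flatness -/

section Compare

variable (k L : Type u) [CommRing k] [CommRing L] [Algebra k L] {n : ℕ} (i : Fin (n + 1))

/-- `φ(xᵢ) = xᵢ` for the base-change map `φ = MvPolynomial.map (algebraMap k L)`. [folklore] -/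
theorem mapGraded_X : mapGraded k L (Fin (n + 1)) (X i) = X i := by
  rw [mapGraded_apply, map_X]

/-- On the generator `x_{i.succAbove j}/xᵢ`, the base-change map of homogeneous localizations gives
`x_{i.succAbove j}/φ(xᵢ)`. [folklore] -/
theorem val_awayMap_chartGen (j : Fin n) :
    (Away.map (mapGraded k L (Fin (n + 1))) (X i) (ProjectiveSpace.chartGen k i j)).val =
      Localization.mk (X (i.succAbove j))
        (⟨mapGraded k L (Fin (n + 1)) (X i) ^ 1, 1, rfl⟩ :
          Submonoid.powers (mapGraded k L (Fin (n + 1)) (X i))) := by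
  rw [val_awayMap, ProjectiveSpace.val_chartGen, Localization.mk_eq_mk', Localization.awayMap,
    IsLocalization.Away.map, IsLocalization.map_mk', ← Localization.mk_eq_mk']
  refine congrArg₂ Localization.mk (by rw [RingHom.coe_coe, mapGraded_apply, map_X]) (Subtype.ext ?_)
  change mapGraded k L (Fin (n + 1)) (X i ^ 1) = mapGraded k L (Fin (n + 1)) (X i) ^ 1
  rw [map_pow]

/-- **The comparison `k[x]⁰_{(xᵢ)} ⊗ₖ L → L[x]⁰_{(xᵢ)}` is injective for every `k`-algebra `L`**:
through the chart isomorphisms it is the base change isomorphism `k[y] ⊗ₖ L ≅ L[y]` of polynomial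
algebras. [cite: Liu2002, Ex. 3.1.10] -/
theorem tensorToAway_X_injective :
    letI := algebraRestrict k L (mapGraded k L (Fin (n + 1)) (X i))
    haveI := isScalarTower_algebraRestrict k L (mapGraded k L (Fin (n + 1)) (X i))
    Function.Injective (tensorToAway k L (X i : MvPolynomial (Fin (n + 1)) k)) := by
  letI := algebraRestrict k L (mapGraded k L (Fin (n + 1)) (X i))
  haveI := isScalarTower_algebraRestrict k L (mapGraded k L (Fin (n + 1)) (X i))
  let ek := ProjectiveSpace.chartAlgEquiv k i
  let eL := chartAlgEquivOfEq L i (mapGraded k L (Fin (n + 1)) (X i)) (mapGraded_X k L i)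
  let Φ := MvPolynomial.algebraTensorAlgEquiv (σ := Fin n) k L
  let E : (Away (homogeneousSubmodule (Fin (n + 1)) k) (X i) ⊗[k] L) ≃ₐ[k]
      (MvPolynomial (Fin n) k ⊗[k] L) := Algebra.TensorProduct.congr ek AlgEquiv.refl
  -- the comparison, read on `k[y] ⊗ L`
  let Ψ₁ : MvPolynomial (Fin n) k ⊗[k] L →ₐ[k]
      Away (homogeneousSubmodule (Fin (n + 1)) L) (mapGraded k L (Fin (n + 1)) (X i)) :=
    (tensorToAway k L (X i)).comp E.symm.toAlgHom
  let Ψ₂ : MvPolynomial (Fin n) k ⊗[k] L →ₐ[k]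
      Away (homogeneousSubmodule (Fin (n + 1)) L) (mapGraded k L (Fin (n + 1)) (X i)) :=
    ((eL.symm.toAlgHom.restrictScalars k).comp (Φ.toAlgHom.restrictScalars k)).comp
      (Algebra.TensorProduct.comm k (MvPolynomial (Fin n) k) L).toAlgHom
  -- they agree on `p ⊗ 1` …
  have hleft : ∀ p : MvPolynomial (Fin n) k, Ψ₁ (p ⊗ₜ 1) = Ψ₂ (p ⊗ₜ 1) := by
    intro p
    have h1 : Ψ₁ (p ⊗ₜ 1) = Away.map (mapGraded k L (Fin (n + 1))) (X i) (ek.symm p) := by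
      change tensorToAway k L (X i) (E.symm (p ⊗ₜ 1)) = _
      rw [show E.symm (p ⊗ₜ[k] (1 : L)) = ek.symm p ⊗ₜ 1 from rfl, tensorToAway_tmul, map_one, mul_one]
    have h2 : Ψ₂ (p ⊗ₜ 1) = eL.symm (MvPolynomial.map (algebraMap k L) p) := by
      change eL.symm (Φ ((Algebra.TensorProduct.comm k _ L) (p ⊗ₜ 1))) = _
      rw [Algebra.TensorProduct.comm_tmul, MvPolynomial.algebraTensorAlgEquiv_tmul, one_smul]
    rw [h1, h2]
    -- two `k`-algebra maps `k[y] → L[x]⁰_(t)` agreeing on the variables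
    let α : MvPolynomial (Fin n) k →ₐ[k]
        Away (homogeneousSubmodule (Fin (n + 1)) L) (mapGraded k L (Fin (n + 1)) (X i)) :=
      (awayMapₐ k L (X i)).comp ek.symm.toAlgHom
    let β : MvPolynomial (Fin n) k →ₐ[k]
        Away (homogeneousSubmodule (Fin (n + 1)) L) (mapGraded k L (Fin (n + 1)) (X i)) :=
      (eL.symm.toAlgHom.restrictScalars k).comp (MvPolynomial.mapAlgHom (Algebra.ofId k L))
    have hαβ : α = β := by
      refine MvPolynomial.algHom_ext fun j => HomogeneousLocalization.val_injective _ ?_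
      change (Away.map (mapGraded k L (Fin (n + 1))) (X i) (ek.symm (X j))).val =
        (eL.symm (MvPolynomial.map (algebraMap k L) (X j))).val
      rw [ProjectiveSpace.chartAlgEquiv_symm_X, val_awayMap_chartGen, map_X,
        val_chartAlgEquivOfEq_symm_X]
    exact congr($hαβ p)
  -- … and on `1 ⊗ c`
  have hright : ∀ c : L, Ψ₁ (1 ⊗ₜ c) = Ψ₂ (1 ⊗ₜ c) := by
    intro c
    have h1 : Ψ₁ (1 ⊗ₜ c) = algebraMap L _ c := by
      change tensorToAway k L (X i) (E.symm (1 ⊗ₜ c)) = _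
      rw [show E.symm ((1 : MvPolynomial (Fin n) k) ⊗ₜ[k] c) = ek.symm 1 ⊗ₜ c from rfl, map_one,
        tensorToAway_tmul, map_one, one_mul]
    have h2 : Ψ₂ (1 ⊗ₜ c) = eL.symm (c • MvPolynomial.map (algebraMap k L) 1) := by
      change eL.symm (Φ ((Algebra.TensorProduct.comm k _ L) (1 ⊗ₜ c))) = _
      rw [Algebra.TensorProduct.comm_tmul, MvPolynomial.algebraTensorAlgEquiv_tmul]
    rw [h1, h2, map_one, Algebra.smul_def, mul_one, AlgEquiv.commutes]
  have hΨ : Ψ₁ = Ψ₂ := Algebra.TensorProduct.ext' fun p c => by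
    rw [show p ⊗ₜ[k] c = (p ⊗ₜ[k] (1 : L)) * ((1 : MvPolynomial (Fin n) k) ⊗ₜ[k] c) by
      rw [Algebra.TensorProduct.tmul_mul_tmul, mul_one, one_mul], map_mul, map_mul, hleft, hright]
  have hΨ₂ : Function.Injective Ψ₂ := fun x y h =>
    (Algebra.TensorProduct.comm k _ L).injective (Φ.injective (eL.symm.injective h))
  intro x y hxy
  have : Ψ₁ (E x) = Ψ₁ (E y) := by
    change tensorToAway k L (X i) (E.symm (E x)) = tensorToAway k L (X i) (E.symm (E y))
    rwa [E.symm_apply_apply, E.symm_apply_apply]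
  rw [hΨ] at this
  exact E.injective (hΨ₂ this)

/-- The comparison `k[x]⁰_{(xᵢ)} ⊗ₖ L → L[x]⁰_{(xᵢ)}` is bijective for every `k`-algebra `L`.
[cite: Liu2002, Ex. 3.1.10] -/
theorem tensorToAway_X_bijective :
    letI := algebraRestrict k L (mapGraded k L (Fin (n + 1)) (X i))
    haveI := isScalarTower_algebraRestrict k L (mapGraded k L (Fin (n + 1)) (X i))
    Function.Bijective (tensorToAway k L (X i : MvPolynomial (Fin (n + 1)) k)) := by
  letI := algebraRestrict k L (mapGraded k L (Fin (n + 1)) (X i))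
  haveI := isScalarTower_algebraRestrict k L (mapGraded k L (Fin (n + 1)) (X i))
  exact ⟨tensorToAway_X_injective k L i, tensorToAway_surjective k L (ProjectiveSpace.X_mem i)⟩

/-- The ring isomorphism `k[x]⁰_{(xᵢ)} ⊗ₖ L ≅ L[x]⁰_{(xᵢ)}` in `CommRingCat`, for every `k`-algebra
`L`. [cite: Liu2002, Ex. 3.1.10] -/
def tensorAwayIsoX :
    CommRingCat.of (Away (homogeneousSubmodule (Fin (n + 1)) k) (X i) ⊗[k] L) ≅
      CommRingCat.of (Away (homogeneousSubmodule (Fin (n + 1)) L) (mapGraded k L (Fin (n + 1)) (X i))) :=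
  letI := algebraRestrict k L (mapGraded k L (Fin (n + 1)) (X i))
  haveI := isScalarTower_algebraRestrict k L (mapGraded k L (Fin (n + 1)) (X i))
  (RingEquiv.ofBijective (tensorToAway k L (X i)).toRingHom
    (tensorToAway_X_bijective k L i)).toCommRingCatIso

/-- `k → k[x]⁰_{(xᵢ)}`, `k → L`, `k[x]⁰_{(xᵢ)} → L[x]⁰_{(xᵢ)}`, `L → L[x]⁰_{(xᵢ)}` is a pushout square
of commutative rings, for every `k`-algebra `L`. [cite: Liu2002, Prop. 3.1.9 (proof)] -/
theorem isPushout_away_X :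
    IsPushout (CommRingCat.ofHom (algebraMap k (Away (homogeneousSubmodule (Fin (n + 1)) k) (X i))))
      (CommRingCat.ofHom (algebraMap k L))
      (CommRingCat.ofHom (Away.map (mapGraded k L (Fin (n + 1))) (X i)))
      (CommRingCat.ofHom (algebraMap L (Away (homogeneousSubmodule (Fin (n + 1)) L)
        (mapGraded k L (Fin (n + 1)) (X i))))) := by
  letI := algebraRestrict k L (mapGraded k L (Fin (n + 1)) (X i))
  haveI := isScalarTower_algebraRestrict k L (mapGraded k L (Fin (n + 1)) (X i))
  refine (CommRingCat.isPushout_tensorProduct k (Away (homogeneousSubmodule (Fin (n + 1)) k) (X i)) L).of_iso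
    (Iso.refl _) (Iso.refl _) (Iso.refl _) (tensorAwayIsoX k L i) (by simp) (by simp) ?_ ?_
  · refine CommRingCat.hom_ext (RingHom.ext fun a => ?_)
    change tensorToAway k L (X i) (a ⊗ₜ 1) = Away.map (mapGraded k L (Fin (n + 1))) (X i) a
    rw [tensorToAway_tmul, map_one, mul_one]
  · refine CommRingCat.hom_ext (RingHom.ext fun c => ?_)
    change tensorToAway k L (X i) (1 ⊗ₜ c) = algebraMap L _ c
    rw [tensorToAway_tmul, map_one, one_mul]

/-- `D₊(xᵢ) ⊆ ℙⁿ_L` is the fibre product `D₊(xᵢ) ×_k L`, for every `k`-algebra `L`.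
[cite: Liu2002, Prop. 3.1.9 (proof)] -/
theorem isPullback_Spec_away_X :
    IsPullback (Spec.map (CommRingCat.ofHom (Away.map (mapGraded k L (Fin (n + 1))) (X i))))
      (Spec.map (CommRingCat.ofHom
        (algebraMap L (Away (homogeneousSubmodule (Fin (n + 1)) L) (mapGraded k L (Fin (n + 1)) (X i))))))
      (Spec.map (CommRingCat.ofHom (algebraMap k (Away (homogeneousSubmodule (Fin (n + 1)) k) (X i)))))
      (Spec.map (CommRingCat.ofHom (algebraMap k L))) :=
  isPullback_SpecMap_of_isPushout _ _ _ _ (isPushout_away_X k L i)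

/-- **`ℙⁿ_L = ℙⁿ_k ×_{Spec k} Spec L` for every `k`-algebra `L`** (Liu 2002, Ex. 3.1.10; Görtz–Wedhorn
I (13.9)): the square formed by `Proj` of the base-change map `k[x] → L[x]` and the structure
morphisms is cartesian. [cite: Liu2002, Prop. 3.1.9 and Ex. 3.1.10] -/
theorem isPullback_projMap' :
    IsPullback (Proj.map (mapGraded k L (Fin (n + 1))) (irrelevant_le_map k L (Fin (n + 1))))
      (projToSpec (Fin (n + 1)) L) (projToSpec (Fin (n + 1)) k)
      (Spec.map (CommRingCat.ofHom (algebraMap k L))) := by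
  refine Scheme.isPullback_of_openCover _ _ _ _
    (Proj.affineOpenCoverOfIrrelevantLESpan (homogeneousSubmodule (Fin (n + 1)) k)
      (fun s : Fin (n + 1) => (X s : MvPolynomial (Fin (n + 1)) k)) (m := fun _ => 1)
      (fun s => ProjectiveSpace.X_mem s) (fun _ => one_pos) (irrelevant_le_span_X k)).openCover
    fun j ↦ ?_
  obtain ⟨i, rfl⟩ : ∃ i : Fin (n + 1), i = j := ⟨j, rfl⟩
  have hd : 0 < 1 := one_pos
  have hs : (X i : MvPolynomial (Fin (n + 1)) k) ∈ homogeneousSubmodule (Fin (n + 1)) k 1 :=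
    ProjectiveSpace.X_mem i
  have hopen : IsPullback
      (Spec.map (CommRingCat.ofHom (Away.map (mapGraded k L (Fin (n + 1))) (X i))))
      (Proj.awayι (homogeneousSubmodule (Fin (n + 1)) L) (mapGraded k L (Fin (n + 1)) (X i))
        ((mapGraded k L (Fin (n + 1))).map_mem hs) hd)
      (Proj.awayι (homogeneousSubmodule (Fin (n + 1)) k) (X i) hs hd)
      (Proj.map (mapGraded k L (Fin (n + 1))) (irrelevant_le_map k L (Fin (n + 1)))) :=
    IsOpenImmersion.isPullback _ _ _ _ (Proj.awayι_comp_map _ _ hd _ hs)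
      (by rw [Proj.opensRange_awayι, Proj.opensRange_awayι, Proj.map_preimage_basicOpen])
  have hSpec := isPullback_Spec_away_X k L i
  refine hSpec.of_iso hopen.flip.isoPullback (Iso.refl _) (Iso.refl _) (Iso.refl _) ?_ ?_ ?_ ?_
  · exact (Category.comp_id _).trans hopen.flip.isoPullback_hom_snd.symm
  · exact (Category.comp_id _).trans
      ((awayι_projToSpec (Fin (n + 1)) ((mapGraded k L (Fin (n + 1))).map_mem hs) hd).symm.trans
        ((congrArg (· ≫ projToSpec (Fin (n + 1)) L) hopen.flip.isoPullback_hom_fst.symm).trans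
          (Category.assoc _ _ _)))
  · exact (Category.comp_id _).trans
      ((awayι_projToSpec (Fin (n + 1)) hs hd).symm.trans (Category.id_comp _).symm)
  · simp

end Compare

end ProjBaseChangeRing

end Literature.AlgebraicGeometry.Motives

end
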